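import Mathlib
import Literature.NumberTheory.EllipticCurves.IwasawaAlgebra
import Summits.BirchSwinnertonDyer.Rank1Residual.X1.GeneratorBoundFitting
import HarnessLib

/-!
# «Growth ⟹ injectivity» over `Λ = ℤ_p⟦T⟧` — compact-side algebra of the weak-Leopoldt road to the
# strict-place surjectivity for the rank-free twin (crux ♭T′ stmt-BirchSwinnertonDyer-26975, line
# `sigmacongruence` v3, stub TS1 `stub_twinStrictSurj`)

Route `UniversalToricDescent`, lead prover `bsd-wall-utd-p1` g15. THEOREMS ONLY (pure commutative algebra over
`Λ = IwasawaAlgebra p = PowerSeries ℤ_[p]`; no definition, no named fact, no `sorry`); `--supports 26975`.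
BSD is not proved by any of this.

THE LEMMA (`injective_of_growth`). `ψ : Q → Y` `Λ`-linear, `Q` finitely generated and torsion-free; ideals
`I m ≤ 𝔪^m` with `Q/I_m Q`, `Y/I_m Y` finite and `#(Q/I_m Q) · #(X/I_m X) ≤ p^{a·m+c} · #(Y/I_m Y)` for all `m`
(`X = Y/ψ(Q)`; typically `#(Q/I_m Q) ≤ p^{d·m·p^m+b}` from the LOCAL Euler characteristic, `#(X/I_m X) ≤
p^{e m+f}` as the cokernel is finitely generated over `ℤ_p`, `#(Y/I_m Y) ≥ p^{d·m·p^m}` = the WEAK LEOPOLDT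
inequality, `I m = (p^m, ω_m)`, `ω_m = (1+T)^{p^m} − 1`: `injective_of_weakLeopoldt_growth`). THEN `ψ` IS
INJECTIVE. Proof: counting along `0 → K → Q → Y → X → 0` gives `#(K/(K ∩ I_m Q)) ≤ p^{a m+c}`; for
`0 ≠ x ∈ K`, Artin–Rees for `Λx ≅ Λ ≤ Q` gives `Λx ∩ 𝔪^{2N+r}Q ≤ 𝔪^{2N}x`, and the `p^{N²}` polynomials
`∑_{i<N} a_i T^i` (`0 ≤ a_i < p^N`) are distinct mod `𝔪^{2N}` (an element of `𝔪^M` has `i`-th coefficient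
divisible by `p^{M−i}`, the tree's `pow_dvd_coeff_of_mem_maximalIdeal_pow`): `p^{N²} ≤ p^{a(2N+r)+c}`, absurd for `N` large. Dual reading (its use for TS1):
`ψ = Φ^∨` for the `𝔭′`-signature `Φ : G_rel^S(K_∞, E′[3^∞]) → ⊕_{w∣𝔭′} H¹(K_{∞,w}, E′[3^∞])`; `ψ` injective
⟺ `Φ` ONTO (Greenberg–Vatsal Prop. 2.1 at the strict place) — without `H²` of the restricted-ramification
group and without base finiteness of the twin.

References: [GreenbergVatsal2000] §2 Prop. (2.1); [GreenbergLNM1716] §4 Prop. 4.13–4.15; [Washington1997]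
§13.2 (Lemma 13.10); Artin–Rees (Mathlib `Ideal.exists_pow_inf_eq_pow_smul`).
-/

set_option autoImplicit false
-- the Theorems namespace of this sub repeats the summit name by design (D-0017 nested layout)
set_option linter.dupNamespace false

noncomputable section

open scoped Classical
open PowerSeries IsLocalRing Literature.NumberTheory.EllipticCurves
  Summit.BirchSwinnertonDyer.Rank1Residual.X1.GeneratorBoundFitting

namespace Summit.BirchSwinnertonDyer.BirchSwinnertonDyer.Theorems.UniversalToricDescentGrowthInjective

variable (p : ℕ) [hp : Fact p.Prime]

/-! ## §1. `ω_n = (1+T)^{p^n} − 1 ∈ 𝔪^{n+1}` and `(p^k, ω_n) ≤ 𝔪^{min k (n+1)}` -/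

/-- `p ∈ 𝔪`. [folklore] -/
theorem natCast_p_mem_maximalIdeal : ((p : ℕ) : IwasawaAlgebra p) ∈ maximalIdeal (IwasawaAlgebra p) := by
  rw [mem_maximalIdeal, mem_nonunits_iff, PowerSeries.isUnit_iff_constantCoeff, map_natCast]
  intro h
  have : ((p : ℕ) : ℤ_[p]) ∈ nonunits ℤ_[p] := by
    rw [← mem_maximalIdeal, PadicInt.maximalIdeal_eq_span_p]; exact Ideal.subset_span rfl
  exact this h

/-- If `x − 1 ∈ 𝔞` then `x^k − 1 ∈ 𝔞`. [folklore] -/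
theorem pow_sub_one_mem {x : IwasawaAlgebra p} {𝔞 : Ideal (IwasawaAlgebra p)} (hx : x - 1 ∈ 𝔞) (k : ℕ) :
    x ^ k - 1 ∈ 𝔞 := by
  rw [← mul_geom_sum x k]
  exact 𝔞.mul_mem_right _ hx

/-- **`ω_n = (1+T)^{p^n} − 1 ∈ 𝔪^{n+1}`**: `ω_{n+1} = ω_n · ∑_{k<p} u^k`, `u = (1+T)^{p^n} ≡ 1 (mod 𝔪)`, and
`∑_{k<p} u^k ≡ p ≡ 0 (mod 𝔪)`. [cite: Washington1997, §13.2 (Lemma 13.10)] -/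
theorem omega_mem_maximalIdeal_pow (n : ℕ) :
    ((1 : IwasawaAlgebra p) + X) ^ (p ^ n) - 1 ∈ maximalIdeal (IwasawaAlgebra p) ^ (n + 1) := by
  induction n with
  | zero =>
    simp only [pow_zero, pow_one, zero_add, add_sub_cancel_left]
    rw [mem_maximalIdeal, mem_nonunits_iff, PowerSeries.isUnit_iff_constantCoeff]
    simp
  | succ n ih =>
    set u : IwasawaAlgebra p := ((1 : IwasawaAlgebra p) + X) ^ (p ^ n) with hu
    have hstep : ((1 : IwasawaAlgebra p) + X) ^ (p ^ (n + 1)) - 1 =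
        (u - 1) * (Finset.range p).sum (fun k ↦ u ^ k) := by
      rw [pow_succ, pow_mul, ← hu, mul_comm, geom_sum_mul]
    -- `∑_{k<p} u^k ∈ 𝔪`
    have hsum : (Finset.range p).sum (fun k ↦ u ^ k) ∈ maximalIdeal (IwasawaAlgebra p) := by
      have hu1 : u - 1 ∈ maximalIdeal (IwasawaAlgebra p) :=
        Ideal.pow_le_self (Nat.succ_ne_zero n) ih
      have h : (Finset.range p).sum (fun k ↦ u ^ k) =
          (Finset.range p).sum (fun k ↦ (u ^ k - 1)) + ((p : ℕ) : IwasawaAlgebra p) := by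
        rw [Finset.sum_sub_distrib, Finset.sum_const, Finset.card_range, nsmul_eq_mul, mul_one,
          sub_add_cancel]
      rw [h]
      exact Ideal.add_mem _ (Ideal.sum_mem _ fun k _ ↦ pow_sub_one_mem p hu1 k)
        (natCast_p_mem_maximalIdeal p)
    rw [hstep, pow_succ]
    exact Ideal.mul_mem_mul ih hsum

/-- **`(p^k, ω_n) ≤ 𝔪^{min k (n+1)}`.** [folklore] -/
theorem span_pow_omega_le (n k : ℕ) :
    Ideal.span {((p : ℕ) : IwasawaAlgebra p) ^ k, ((1 : IwasawaAlgebra p) + X) ^ (p ^ n) - 1} ≤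
      maximalIdeal (IwasawaAlgebra p) ^ (min k (n + 1)) := by
  rw [Ideal.span_le]
  rintro x (rfl | rfl)
  · exact Ideal.pow_le_pow_right (min_le_left _ _) (Ideal.pow_mem_pow (natCast_p_mem_maximalIdeal p) k)
  · exact Ideal.pow_le_pow_right (min_le_right _ _) (omega_mem_maximalIdeal_pow p n)

/-! ## §2. Counting along `0 → K → Q → Y → X → 0` modulo an ideal -/

section Counting

variable {R : Type*} [CommRing R] {Q Y : Type*} [AddCommGroup Q] [Module R Q] [AddCommGroup Y] [Module R Y]
  (ψ : Q →ₗ[R] Y) (I : Ideal R)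

/-- The kernel of `Q/IQ ↠ Q/(K + IQ)` is the image of `K`, which is `K/(K ∩ IQ)`:
`#(Q/IQ) = #(K/(K ∩ IQ)) · #(Q/(K + IQ))`. [folklore] -/
theorem natCard_quot_eq_mul [Finite (Q ⧸ (I • ⊤ : Submodule R Q))] :
    Nat.card (Q ⧸ (I • ⊤ : Submodule R Q)) =
      Nat.card (LinearMap.ker ψ ⧸ (Submodule.comap (LinearMap.ker ψ).subtype (I • ⊤ : Submodule R Q))) *
        Nat.card (Q ⧸ (LinearMap.ker ψ ⊔ (I • ⊤ : Submodule R Q))) := by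
  set K := LinearMap.ker ψ
  set IQ : Submodule R Q := I • ⊤
  let π : (Q ⧸ IQ) →ₗ[R] (Q ⧸ (K ⊔ IQ)) := Submodule.factor le_sup_right
  have hπ : Function.Surjective π := Submodule.factor_surjective le_sup_right
  let j : K →ₗ[R] (Q ⧸ IQ) := IQ.mkQ ∘ₗ K.subtype
  have hjker : LinearMap.ker j = Submodule.comap K.subtype IQ := by
    ext k
    simp only [j, LinearMap.mem_ker, LinearMap.coe_comp, Function.comp_apply, Submodule.mkQ_apply,
      Submodule.Quotient.mk_eq_zero, Submodule.mem_comap, Submodule.subtype_apply, IQ, K]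
  have hjrange : LinearMap.range j = LinearMap.ker π := by
    ext z
    obtain ⟨q, rfl⟩ := IQ.mkQ_surjective z
    simp only [LinearMap.mem_range, LinearMap.mem_ker, j, π, LinearMap.coe_comp, Function.comp_apply,
      Submodule.mkQ_apply, Submodule.mapQ_apply, LinearMap.id_coe, id_eq, Submodule.Quotient.mk_eq_zero]
    constructor
    · rintro ⟨k, hk⟩
      rw [Submodule.Quotient.eq] at hk
      have : q = (k : Q) - ((k : Q) - q) := by abel
      rw [this]
      exact Submodule.sub_mem _ (Submodule.mem_sup_left k.2) (Submodule.mem_sup_right hk)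
    · intro hq
      obtain ⟨k, hk, y, hy, rfl⟩ := Submodule.mem_sup.mp hq
      refine ⟨⟨k, hk⟩, ?_⟩
      rw [Submodule.Quotient.eq]
      simpa using IQ.neg_mem hy
  have e1 : (K ⧸ Submodule.comap K.subtype IQ) ≃ₗ[R] LinearMap.ker π := by
    rw [← hjker, ← hjrange]; exact j.quotKerEquivRange
  have e2 : ((Q ⧸ IQ) ⧸ LinearMap.ker π) ≃ₗ[R] (Q ⧸ (K ⊔ IQ)) := π.quotKerEquivOfSurjective hπ
  rw [Submodule.card_eq_card_quotient_mul_card (LinearMap.ker π), Nat.card_congr e1.toEquiv.symm,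
    Nat.card_congr e2.toEquiv, mul_comm]

/-- The quotient `K/(K ∩ IQ)` is finite when `Q/IQ` is. [folklore] -/
theorem finite_ker_quot_kerInf [Finite (Q ⧸ (I • ⊤ : Submodule R Q))] :
    Finite (LinearMap.ker ψ ⧸ (Submodule.comap (LinearMap.ker ψ).subtype (I • ⊤ : Submodule R Q))) := by
  have h := natCard_quot_eq_mul ψ I
  have hne : Nat.card (Q ⧸ (I • ⊤ : Submodule R Q)) ≠ 0 := Nat.card_pos.ne'
  rw [h] at hne
  exact Nat.finite_of_card_ne_zero (mul_ne_zero_iff.mp hne).1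

/-- `Y/IY` surjects onto `X/IX` (`X = Y/ψ(Q)`) with kernel inside the image of `Q/(K + IQ)`:
`#(Y/IY) ≤ #(X/IX) · #(Q/(K + IQ))`. [folklore] -/
theorem natCard_quot_le_mul [Finite (Q ⧸ (I • ⊤ : Submodule R Q))] [Finite (Y ⧸ (I • ⊤ : Submodule R Y))] :
    Nat.card (Y ⧸ (I • ⊤ : Submodule R Y)) ≤
      Nat.card ((Y ⧸ LinearMap.range ψ) ⧸ (I • ⊤ : Submodule R (Y ⧸ LinearMap.range ψ))) *
        Nat.card (Q ⧸ (LinearMap.ker ψ ⊔ (I • ⊤ : Submodule R Q))) := by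
  set K := LinearMap.ker ψ
  set IQ : Submodule R Q := I • ⊤
  set IY : Submodule R Y := I • ⊤
  set X := Y ⧸ LinearMap.range ψ
  set IX : Submodule R X := I • ⊤
  have hIX : IX = IY.map (LinearMap.range ψ).mkQ := by
    simp only [IX, IY, Submodule.map_smul'', Submodule.map_top, Submodule.range_mkQ]
  let ρ : (Y ⧸ IY) →ₗ[R] (X ⧸ IX) := Submodule.mapQ IY IX (LinearMap.range ψ).mkQ (by
    rw [hIX]; exact Submodule.le_comap_map _ _)
  have hρ : Function.Surjective ρ := by
    intro z
    obtain ⟨x, rfl⟩ := IX.mkQ_surjective z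
    obtain ⟨y, rfl⟩ := (LinearMap.range ψ).mkQ_surjective x
    exact ⟨IY.mkQ y, rfl⟩
  have hle : K ⊔ IQ ≤ LinearMap.ker (IY.mkQ ∘ₗ ψ) := by
    refine sup_le (fun k hk ↦ ?_) ?_
    · rw [LinearMap.mem_ker, LinearMap.comp_apply, show ψ k = 0 from hk, map_zero]
    · rw [Submodule.smul_le]
      intro r hr q _
      rw [LinearMap.mem_ker, LinearMap.comp_apply, LinearMap.map_smul, Submodule.mkQ_apply,
        Submodule.Quotient.mk_eq_zero]
      exact Submodule.smul_mem_smul hr Submodule.mem_top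
  let g : (Q ⧸ (K ⊔ IQ)) →ₗ[R] (Y ⧸ IY) := (K ⊔ IQ).liftQ (IY.mkQ ∘ₗ ψ) hle
  have hker : LinearMap.ker ρ ≤ LinearMap.range g := by
    intro z hz
    obtain ⟨y, rfl⟩ := IY.mkQ_surjective z
    simp only [LinearMap.mem_ker, ρ, Submodule.mkQ_apply, Submodule.mapQ_apply, Submodule.Quotient.mk_eq_zero,
      hIX, Submodule.mem_map] at hz
    obtain ⟨y', hy', hyy'⟩ := hz
    have hyy'' : y' - y ∈ LinearMap.range ψ := by
      rw [Submodule.mkQ_apply, Submodule.mkQ_apply] at hyy'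
      exact (Submodule.Quotient.eq _).mp hyy'
    obtain ⟨q, hq⟩ := LinearMap.mem_range.mp hyy''
    refine ⟨(K ⊔ IQ).mkQ (-q), ?_⟩
    simp only [g, Submodule.mkQ_apply, Submodule.liftQ_apply, LinearMap.coe_comp, Function.comp_apply, map_neg,
      hq, ← Submodule.Quotient.mk_neg]
    rw [Submodule.Quotient.eq]
    have : -(y' - y) - y = -y' := by abel
    rw [this]
    exact IY.neg_mem hy'
  haveI : Finite (Q ⧸ (K ⊔ IQ)) :=
    Finite.of_surjective (Submodule.factor (le_sup_right : IQ ≤ K ⊔ IQ)) (Submodule.factor_surjective _)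
  haveI : Finite (LinearMap.range g) := Finite.of_surjective g.rangeRestrict g.surjective_rangeRestrict
  have h1 : Nat.card (LinearMap.ker ρ) ≤ Nat.card (Q ⧸ (K ⊔ IQ)) :=
    (Nat.card_le_card_of_injective (Submodule.inclusion hker) (Submodule.inclusion_injective hker)).trans
      (Nat.card_le_card_of_surjective g.rangeRestrict g.surjective_rangeRestrict)
  have e2 : ((Y ⧸ IY) ⧸ LinearMap.ker ρ) ≃ₗ[R] (X ⧸ IX) := ρ.quotKerEquivOfSurjective hρ
  rw [Submodule.card_eq_card_quotient_mul_card (LinearMap.ker ρ), Nat.card_congr e2.toEquiv, mul_comm]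
  exact Nat.mul_le_mul_left _ h1

/-- **The kernel bound.** If `#(Q/IQ) · #(X/IX) ≤ B · #(Y/IY)` then `#(K/(K ∩ IQ)) ≤ B`. [folklore] -/
theorem natCard_ker_quot_le [Finite (Q ⧸ (I • ⊤ : Submodule R Q))] [Finite (Y ⧸ (I • ⊤ : Submodule R Y))]
    {B : ℕ} (hB : Nat.card (Q ⧸ (I • ⊤ : Submodule R Q)) *
      Nat.card ((Y ⧸ LinearMap.range ψ) ⧸ (I • ⊤ : Submodule R (Y ⧸ LinearMap.range ψ))) ≤
        B * Nat.card (Y ⧸ (I • ⊤ : Submodule R Y))) :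
    Nat.card (LinearMap.ker ψ ⧸ (Submodule.comap (LinearMap.ker ψ).subtype (I • ⊤ : Submodule R Q))) ≤ B := by
  have hY : 0 < Nat.card (Y ⧸ (I • ⊤ : Submodule R Y)) := Nat.card_pos
  have h1 := natCard_quot_eq_mul ψ I
  have h2 := natCard_quot_le_mul ψ I
  -- `#K/K_I · #Y/IY ≤ #K/K_I · #X/IX · #Q/(K+IQ) = #Q/IQ · #X/IX ≤ B · #Y/IY`
  have h3 : Nat.card (LinearMap.ker ψ ⧸ (Submodule.comap (LinearMap.ker ψ).subtype (I • ⊤ : Submodule R Q))) * Nat.card (Y ⧸ (I • ⊤ : Submodule R Y)) ≤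
      B * Nat.card (Y ⧸ (I • ⊤ : Submodule R Y)) := by
    calc Nat.card (LinearMap.ker ψ ⧸ (Submodule.comap (LinearMap.ker ψ).subtype (I • ⊤ : Submodule R Q))) * Nat.card (Y ⧸ (I • ⊤ : Submodule R Y))
        ≤ Nat.card (LinearMap.ker ψ ⧸ (Submodule.comap (LinearMap.ker ψ).subtype (I • ⊤ : Submodule R Q))) *
            (Nat.card ((Y ⧸ LinearMap.range ψ) ⧸ (I • ⊤ : Submodule R (Y ⧸ LinearMap.range ψ))) *
              Nat.card (Q ⧸ (LinearMap.ker ψ ⊔ (I • ⊤ : Submodule R Q)))) := Nat.mul_le_mul_left _ h2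
      _ = Nat.card (Q ⧸ (I • ⊤ : Submodule R Q)) *
            Nat.card ((Y ⧸ LinearMap.range ψ) ⧸ (I • ⊤ : Submodule R (Y ⧸ LinearMap.range ψ))) := by
          rw [h1]; ring
      _ ≤ B * Nat.card (Y ⧸ (I • ⊤ : Submodule R Y)) := hB
  exact Nat.le_of_mul_le_mul_right h3 hY

end Counting

/-! ## §3. The main lemma -/

/-- Coefficients of `∑_{j<N} a_j T^j`: the `i`-th one is `a_i` (`i < N`). [folklore] -/
theorem coeff_polyOf {N : ℕ} (a : Fin N → ZMod (p ^ N)) (i : Fin N) :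
    coeff (i : ℕ) (∑ i : Fin N, C (((a i).val : ℕ) : ℤ_[p]) * X ^ (i : ℕ)) = (((a i).val : ℕ) : ℤ_[p]) := by
  simp only [map_sum, PowerSeries.coeff_C_mul_X_pow]
  rw [Finset.sum_eq_single i]
  · simp
  · intro j _ hj
    rw [if_neg]
    exact fun h => hj (Fin.ext h).symm
  · intro h; exact absurd (Finset.mem_univ i) h

/-- **Distinct residue vectors give polynomials distinct modulo `𝔪^{2N}`** (the `i`-th coefficient of the
difference, `i < N`, is divisible by `p^{2N−i}`, `2N − i > N`). [folklore] -/
theorem polyOf_injective_mod {N : ℕ} {a b : Fin N → ZMod (p ^ N)}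
    (h : (∑ i : Fin N, C (((a i).val : ℕ) : ℤ_[p]) * X ^ (i : ℕ)) -
      (∑ i : Fin N, C (((b i).val : ℕ) : ℤ_[p]) * X ^ (i : ℕ)) ∈ maximalIdeal (IwasawaAlgebra p) ^ (2 * N)) :
    a = b := by
  funext i
  have hi := pow_dvd_coeff_of_mem_maximalIdeal_pow h i
  rw [map_sub, coeff_polyOf, coeff_polyOf] at hi
  have hN : (p : ℤ_[p]) ^ N ∣ (((a i).val : ℕ) : ℤ_[p]) - (((b i).val : ℕ) : ℤ_[p]) :=
    (pow_dvd_pow _ (by omega)).trans hi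
  have hint : (p : ℤ_[p]) ^ N ∣ ((((a i).val : ℤ) - ((b i).val : ℤ) : ℤ) : ℤ_[p]) := by
    push_cast at hN ⊢; exact hN
  rw [PadicInt.pow_p_dvd_int_iff] at hint
  have hab : (((b i).val : ℤ) : ZMod (p ^ N)) = (((a i).val : ℤ) : ZMod (p ^ N)) := by
    rw [ZMod.intCast_eq_intCast_iff_dvd_sub]; exact_mod_cast hint
  simpa [ZMod.natCast_zmod_val] using hab.symm

/-- **GROWTH ⟹ INJECTIVITY** (see the module docstring): `Q` finitely generated torsion-free, `I m ≤ 𝔪^m`,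
`Q/I_m Q`, `Y/I_m Y` finite, `#(Q/I_m Q)·#(X/I_m X) ≤ p^{a m + c}·#(Y/I_m Y)` (`X = Y/ψ(Q)`) ⟹ `ψ` injective.
[cite: GreenbergVatsal2000, §2 Prop. (2.1)] [cite: GreenbergLNM1716, §4 Prop. 4.13–4.15] -/
theorem injective_of_growth {Q Y : Type*} [AddCommGroup Q] [Module (IwasawaAlgebra p) Q]
    [AddCommGroup Y] [Module (IwasawaAlgebra p) Y] [Module.Finite (IwasawaAlgebra p) Q]
    [NoZeroSMulDivisors (IwasawaAlgebra p) Q] (ψ : Q →ₗ[IwasawaAlgebra p] Y)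
    (I : ℕ → Ideal (IwasawaAlgebra p)) (a c : ℕ)
    (hI : ∀ m, I m ≤ maximalIdeal (IwasawaAlgebra p) ^ m)
    (hQfin : ∀ m, Finite (Q ⧸ (I m • ⊤ : Submodule (IwasawaAlgebra p) Q)))
    (hYfin : ∀ m, Finite (Y ⧸ (I m • ⊤ : Submodule (IwasawaAlgebra p) Y)))
    (hgrowth : ∀ m, Nat.card (Q ⧸ (I m • ⊤ : Submodule (IwasawaAlgebra p) Q)) *
      Nat.card ((Y ⧸ LinearMap.range ψ) ⧸ (I m • ⊤ : Submodule (IwasawaAlgebra p) (Y ⧸ LinearMap.range ψ))) ≤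
        p ^ (a * m + c) * Nat.card (Y ⧸ (I m • ⊤ : Submodule (IwasawaAlgebra p) Y))) :
    Function.Injective ψ := by
  set Λ := IwasawaAlgebra p
  set 𝔪 := maximalIdeal Λ
  set K := LinearMap.ker ψ
  rw [← LinearMap.ker_eq_bot]
  by_contra hK
  obtain ⟨x, hxK, hx0⟩ := (Submodule.ne_bot_iff K).mp hK
  -- Artin–Rees for the line `L = Λx`
  set L : Submodule Λ Q := Submodule.span Λ {x}
  obtain ⟨r, hr⟩ := Ideal.exists_pow_inf_eq_pow_smul 𝔪 L
  set N := 2 * a + r + c + 1 with hNdef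
  set m := 2 * N + r with hmdef
  haveI := hQfin m
  haveI := hYfin m
  haveI : Finite (K ⧸ (Submodule.comap K.subtype (I m • ⊤ : Submodule Λ Q))) := finite_ker_quot_kerInf ψ (I m)
  have hup : Nat.card (K ⧸ (Submodule.comap K.subtype (I m • ⊤ : Submodule Λ Q))) ≤ p ^ (a * m + c) :=
    natCard_ker_quot_le ψ (I m) (hgrowth m)
  -- the injection `(Fin N → ZMod (p^N)) ↪ K ⧸ K_{I m}`, `v ↦ (∑ v_i T^i)·x`
  let P : (Fin N → ZMod (p ^ N)) → Λ := fun v ↦ ∑ i : Fin N, C (((v i).val : ℕ) : ℤ_[p]) * X ^ (i : ℕ)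
  let φ : (Fin N → ZMod (p ^ N)) → K ⧸ (Submodule.comap K.subtype (I m • ⊤ : Submodule Λ Q)) :=
    fun v ↦ Submodule.Quotient.mk ⟨P v • x, K.smul_mem _ hxK⟩
  have hφ : Function.Injective φ := by
    intro v w hvw
    have hmem : (P v - P w) • x ∈ (I m • ⊤ : Submodule Λ Q) := by
      have := (Submodule.Quotient.eq _).mp hvw
      simpa [Submodule.mem_comap, sub_smul] using this
    have hmem' : (P v - P w) • x ∈ 𝔪 ^ m • (⊤ : Submodule Λ Q) ⊓ L :=
      ⟨Submodule.smul_mono_left (hI m) hmem, Submodule.smul_mem _ _ (Submodule.mem_span_singleton_self x)⟩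
    rw [hr m (by omega), show m - r = 2 * N by omega] at hmem'
    have hmem'' : (P v - P w) • x ∈ 𝔪 ^ (2 * N) • L :=
      Submodule.smul_mono le_rfl inf_le_right hmem'
    obtain ⟨g, hg, hgx⟩ := (Submodule.mem_smul_span_singleton).mp hmem''
    have heq : g = P v - P w := by
      have h0 : (g - (P v - P w)) • x = 0 := by rw [sub_smul, hgx, sub_self]
      exact sub_eq_zero.mp ((smul_eq_zero.mp h0).resolve_right hx0)
    exact polyOf_injective_mod p (heq ▸ hg)
  have hlow : p ^ (N * N) ≤ Nat.card (K ⧸ (Submodule.comap K.subtype (I m • ⊤ : Submodule Λ Q))) := by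
    have := Nat.card_le_card_of_injective φ hφ
    rwa [Nat.card_fun, Nat.card_eq_fintype_card, ZMod.card, Nat.card_eq_fintype_card, Fintype.card_fin,
      ← pow_mul] at this
  have hNN : N * N ≤ a * m + c := (Nat.pow_le_pow_iff_right hp.out.one_lt).mp (hlow.trans hup)
  -- contradiction: `N² > a(2N + r) + c` for `N = 2a + r + c + 1`
  have : a * m + c < N * N := by
    rw [hmdef, hNdef]; nlinarith
  omega

/-- The diagonal ideals `I m = (p^m, ω_m)` satisfy `I m ≤ 𝔪^m`. [folklore] -/
theorem span_pow_omega_diag_le (m : ℕ) :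
    Ideal.span {((p : ℕ) : IwasawaAlgebra p) ^ m, ((1 : IwasawaAlgebra p) + X) ^ (p ^ m) - 1} ≤
      maximalIdeal (IwasawaAlgebra p) ^ m :=
  (span_pow_omega_le p m m).trans (Ideal.pow_le_pow_right (by omega))

/-- **GROWTH ⟹ INJECTIVITY, weak-Leopoldt form.** With `I m = (p^m, ω_m)`: if `#(Q/I_m Q) ≤ p^{d m p^m + b}`,
`#(X/I_m X) ≤ p^{e m + f}` and `p^{d m p^m} ≤ #(Y/I_m Y)` for all `m`, then `ψ` is injective.
[cite: GreenbergVatsal2000, §2 Prop. (2.1)] -/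
theorem injective_of_weakLeopoldt_growth {Q Y : Type*} [AddCommGroup Q] [Module (IwasawaAlgebra p) Q]
    [AddCommGroup Y] [Module (IwasawaAlgebra p) Y] [Module.Finite (IwasawaAlgebra p) Q]
    [NoZeroSMulDivisors (IwasawaAlgebra p) Q] (ψ : Q →ₗ[IwasawaAlgebra p] Y) (d b e f : ℕ)
    (hQfin : ∀ m, Finite (Q ⧸ ((Ideal.span {((p : ℕ) : IwasawaAlgebra p) ^ m,
      ((1 : IwasawaAlgebra p) + X) ^ (p ^ m) - 1}) • ⊤ : Submodule (IwasawaAlgebra p) Q)))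
    (hYfin : ∀ m, Finite (Y ⧸ ((Ideal.span {((p : ℕ) : IwasawaAlgebra p) ^ m,
      ((1 : IwasawaAlgebra p) + X) ^ (p ^ m) - 1}) • ⊤ : Submodule (IwasawaAlgebra p) Y)))
    (hQ : ∀ m, Nat.card (Q ⧸ ((Ideal.span {((p : ℕ) : IwasawaAlgebra p) ^ m,
      ((1 : IwasawaAlgebra p) + X) ^ (p ^ m) - 1}) • ⊤ : Submodule (IwasawaAlgebra p) Q)) ≤
        p ^ (d * m * p ^ m + b))
    (hX : ∀ m, Nat.card ((Y ⧸ LinearMap.range ψ) ⧸ ((Ideal.span {((p : ℕ) : IwasawaAlgebra p) ^ m,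
      ((1 : IwasawaAlgebra p) + X) ^ (p ^ m) - 1}) • ⊤ : Submodule (IwasawaAlgebra p) (Y ⧸ LinearMap.range ψ)))
        ≤ p ^ (e * m + f))
    (hY : ∀ m, p ^ (d * m * p ^ m) ≤ Nat.card (Y ⧸ ((Ideal.span {((p : ℕ) : IwasawaAlgebra p) ^ m,
      ((1 : IwasawaAlgebra p) + X) ^ (p ^ m) - 1}) • ⊤ : Submodule (IwasawaAlgebra p) Y))) :
    Function.Injective ψ := by
  refine injective_of_growth p ψ (fun m ↦ Ideal.span {((p : ℕ) : IwasawaAlgebra p) ^ m,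
    ((1 : IwasawaAlgebra p) + X) ^ (p ^ m) - 1}) e (b + f) (span_pow_omega_diag_le p) hQfin hYfin ?_
  intro m
  calc _ ≤ p ^ (d * m * p ^ m + b) * p ^ (e * m + f) := Nat.mul_le_mul (hQ m) (hX m)
    _ = p ^ (e * m + (b + f)) * p ^ (d * m * p ^ m) := by rw [← pow_add, ← pow_add]; ring_nf
    _ ≤ p ^ (e * m + (b + f)) * _ := Nat.mul_le_mul_left _ (hY m)

end Summit.BirchSwinnertonDyer.BirchSwinnertonDyer.Theorems.UniversalToricDescentGrowthInjective

end
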